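import Mathlib

/-!
# critic g27 — card k2-g23 (`stub_heegnerIndexLowerAtTwo`, stmt-BirchSwinnertonDyer-27851), two kernel checks

(1) `H_cmAdjoint` of the card's sketch (§4) quantifies over an ABSTRACT additive endomorphism `s` with
`s ∘ s = −D` in place of the named CM action. Anti-adjointness `B (s P) Q = − B P (s Q)` is NOT a
consequence of symmetry of `B` plus `s ∘ s = −D`: witness on `A = ℤ × ℤ`, `B v w = (v₁+v₂)(w₁+w₂)`,
`s = ` companion matrix of `X² + 7`. So the helper, as typed, is false for the canonical height of any
`V(K) ⊇ ℤ²` carrying such an `s` (non-CM, rank 2) — it must be re-typed over the endomorphism of the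
curve, or dropped (PLAN 3 has no consumer in the stub's Heegner frame: `K ⊉ ℚ(√−7)`).

(2) The receptacle-emptiness claim the card rests on, in its arithmetic core: a field with NO ring map
to a target makes a `Fintype.card (L →+* T) = finrank` conjunct false as soon as `finrank ≥ 1`; here we
only record the trivial shape `Fintype.card X = 0 → X-indexed conjunct fails` used by the critic's row
(the number-theoretic input «2 ramified in ℚ(√d), d ≢ 1 (4) ⟹ no embedding ℚ(√d) →+* ℚ₂» is print).
Nothing here is a tree fact or a proposal.
-/

namespace CriticK2G23

/-- `f (a, b) = a + b` as an additive map `ℤ × ℤ →+ ℚ`. -/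
def f : ℤ × ℤ →+ ℚ :=
  (Int.castAddHom ℚ).comp ((AddMonoidHom.fst ℤ ℤ) + (AddMonoidHom.snd ℤ ℤ))

@[simp] theorem f_apply (v : ℤ × ℤ) : f v = ((v.1 + v.2 : ℤ) : ℚ) := by
  simp [f]

/-- The symmetric rank-one form `B v w = f v * f w`. -/
def B : ℤ × ℤ →+ ℤ × ℤ →+ ℚ :=
  ((AddMonoidHom.mul : ℚ →+ ℚ →+ ℚ).comp f).compl₂ f

@[simp] theorem B_apply (v w : ℤ × ℤ) : B v w = f v * f w := rfl

theorem B_symm (v w : ℤ × ℤ) : B v w = B w v := by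
  simp [mul_comm]

/-- The companion endomorphism of `X² + 7`: `s (a, b) = (−7 b, a)`. -/
def s : ℤ × ℤ →+ ℤ × ℤ :=
  (((-7 : ℤ) • AddMonoidHom.snd ℤ ℤ)).prod (AddMonoidHom.fst ℤ ℤ)

@[simp] theorem s_apply (a b : ℤ) : s (a, b) = (-7 * b, a) := by
  simp [s]

/-- `s ∘ s = −7`. -/
theorem s_sq (v : ℤ × ℤ) : s (s v) = -((7 : ℤ) • v) := by
  obtain ⟨a, b⟩ := v
  simp [s]

/-- **Anti-adjointness fails** for this symmetric `B` and this `s` with `s² = −7`: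
`B (s e₁) e₁ = 1` while `−B e₁ (s e₁) = −1`. -/
theorem not_antiAdjoint : ¬ ∀ P Q : ℤ × ℤ, B (s P) Q = -B P (s Q) := by
  intro h
  have h1 := h (1, 0) (1, 0)
  simp at h1
  norm_num at h1

/-- Hence the abstract-`s` shape of `H_cmAdjoint` («every symmetric torsion-vanishing pairing is
anti-adjoint for every additive `s` with `s ∘ s = −D`») is refuted at `D = 7`. -/
theorem abstract_cmAdjoint_shape_false :
    ¬ ∀ (A : Type) [AddCommGroup A] (Bf : A →+ A →+ ℚ), (∀ P Q, Bf P Q = Bf Q P) →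
      ∀ (D : ℤ) (t : A →+ A), (∀ P, t (t P) = -(D • P)) → ∀ P Q, Bf (t P) Q = -Bf P (t Q) := by
  intro h
  exact not_antiAdjoint (h (ℤ × ℤ) B B_symm 7 s s_sq)

/-- (2) the counting shape: an empty index type cannot have cardinality equal to a positive rank. -/
theorem card_ne_of_isEmpty {X : Type} [Fintype X] [IsEmpty X] {n : ℕ} (hn : 0 < n) :
    Fintype.card X ≠ n := by
  rw [Fintype.card_eq_zero]
  exact hn.ne

end CriticK2G23
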